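import Summits.CriticalPhenomena.PercolationContinuityZ3.Theorems.FK.BoxClusterSizeTransport
import Summits.CriticalPhenomena.PercolationContinuityZ3.Theorems.FK.PressureQDerivatives
import Summits.CriticalPhenomena.PercolationContinuityZ3.Theorems.FK.LatticeEdgeCounting
import HarnessLib

/-!
# FK-continuity cell, FO-10a: the mean number of open clusters PER SITE of the wired box measures converges to the
# wired cluster density — `|Λ_N|⁻¹ φ¹_{Λ_N,p,q}(k¹(ω)) → κ¹(p,q) = φ¹_{p,q}(|C_0|⁻¹)` (Grimmett 2006, (4.81)–(4.83), wired
# side, as a two-sided limit and WITHOUT the ergodic theorem)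

Registered R109 (cell INBOX l.7500, 2026-08-25); registry row FO-10a-g341; label CCL-C (coordinator fk-4 g227).
Cell `fk-continuity` (bschramm), row FO-10a (domain-Markov + comparison layer over FO-06); support file for the
FK-continuity transplant (`--supports stmt-CriticalPhenomena-4575`); builds on p205010 (kernel theorem, internal audit
signed; external expert review pending). Pure proofs; no definitions, no named facts, no sorries; `d ≥ 1`.
UNCONDITIONAL finite- and infinite-volume structure; it decides nothing about FH / TP_FK / the value of `p_c(q)`.

The tree's `BoxClusterCountWired.lean` (KAP-E) has the one-sided bound `E¹_{Λ_N}[k¹] ≤ |Λ_N| κ¹ + 2` for the wired count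
`k¹(ω) = k^{∂Λ_N}(ω)` (all clusters meeting `∂Λ_N` count as one). This file proves the matching lower bound and hence the
LIMIT, for `0 ≤ p ≤ 1`, `q ≥ 1`, `d ≥ 1`:

  `|Λ_N|⁻¹ E¹_{Λ_N,p,q}[k¹(ω)] → κ¹(p,q) = ∫ |C_0|⁻¹ dφ¹_{p,q}`   (`tendsto_rcExpect_clusterCount_div_card_box_true`).

Lower bound by DEEP SITES: `k^B(ω) ≥ Σ_x 1{C_x ∩ B = ∅}·|C_x|⁻¹` (wiring merges only the clusters meeting `B`; the
converse of KAP-D's bound); `1{C_x ∩ ∂Λ_N = ∅}·|C_x|⁻¹ ≥ Σ_{k=2}^{K} 1{C_x ∩ ∂Λ_N = ∅, |C_x| < k}/((k−1)k)` (KAP-E's level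
decomposition); a cluster of a deep site `x` (`x + Λ_m ⊆ Λ_N`, `k ≤ K ≤ m`) with fewer than `k` vertices cannot reach `∂Λ_N`,
and `φ¹_{Λ_N}(|C_x| < k) ≥ 1 − φ¹_{Λ_m}(|C_0| ≥ k)` (`BoxClusterSizeTransport`). Hence `|Λ_N|⁻¹ E¹_{Λ_N}[k¹] ≥
(|Λ_{N−m}|/|Λ_N|)·Σ_{k=2}^{K} (1 − φ¹_{Λ_m}(|C_0| ≥ k))/((k−1)k) → Σ_{k=2}^{K} (1 − φ¹(|C_0| ≥ k))/((k−1)k) ≥ κ¹ − 2/K`.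

* `sum_ite_inv_ncard_le_clusterCount` — `Σ_x 1{C_x(ω) ∩ B = ∅}·|C_x(ω)|⁻¹ ≤ k^B(ω)` on a finite vertex type;
* `sum_le_rcExpect_ite_inv_ncard_true_of_deep` — per deep site;
* `mul_sum_le_rcExpect_clusterCount_true_div` — the sum over the box;
* `eventually_le_rcExpect_clusterCount_true_div` — `∀ ε > 0`, eventually `κ¹ − ε ≤ |Λ_N|⁻¹ E¹_{Λ_N}[k¹]`;
* **`tendsto_rcExpect_clusterCount_div_card_box_true`** — the limit (upper half from KAP-E / `PressureQDerivatives`).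

## References

* G. Grimmett, *The Random-Cluster Model*, Springer 2006 (`book:grimmett2006-random-cluster-model`): §4.5, Thm. (4.58),
  proof of Lemma (4.79), (4.80)–(4.84) [PDF pp. 93–94]; §4.2 (4.12) (the wired count); Thm. (4.19)(a) eq. (4.24). [Grimmett2006]
* G. Grimmett, *Percolation*, 2nd ed., Springer 1999: Thm. (4.2) (number of clusters per vertex), §4.1. [GrimmettPercolation1999]
-/

noncomputable section

open scoped Classical
open Finset Filter Topology MeasureTheory

namespace Summit.CriticalPhenomena.PercolationContinuityZ3.Theorems.FK

open Literature.Probability.Percolation Literature.Probability.LatticeModels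

/-! ### Combinatorics: the clusters avoiding the wired set survive the wiring -/

section Comb

variable {V : Type*} [Fintype V]

/-- **`Σ_x 1{C_x(ω) ∩ B = ∅}·|C_x(ω)|⁻¹ ≤ k^B(ω)`** on a finite vertex type: distinct clusters avoiding the wired set `B`
remain distinct connected components of `openGraph ω ⊔ wired B` (an edge of the wiring starts in `B`), and there are
`Σ_x 1{C_x ∩ B = ∅}·|C_x|⁻¹` of them (double counting). [cite: Grimmett2006, §4.2 (4.12) and proof of Thm. (4.58)] -/
theorem sum_ite_inv_ncard_le_clusterCount (ω : BondConfig V) (B : Set V) :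
    ∑ x : V, (if Disjoint (openCluster ω x) B then (((openCluster ω x).ncard : ℝ))⁻¹ else 0) ≤ (clusterCount ω B : ℝ) := by
  classical
  set φ : (openGraph ω).ConnectedComponent → (openGraph ω ⊔ wired B).ConnectedComponent :=
    SimpleGraph.ConnectedComponent.map
      (SimpleGraph.Hom.ofLE (le_sup_left : openGraph ω ≤ openGraph ω ⊔ wired B)) with hφ
  have hφmk : ∀ x : V, φ ((openGraph ω).connectedComponentMk x) = (openGraph ω ⊔ wired B).connectedComponentMk x :=
    fun x => rfl
  set D : Finset (openGraph ω).ConnectedComponent := Finset.univ.filter fun c => Disjoint c.supp B with hD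
  -- a walk of `openGraph ω ⊔ wired B` started in an open cluster avoiding `B` never uses a wiring edge
  have hreach : ∀ x : V, Disjoint (((openGraph ω).connectedComponentMk x).supp) B →
      ∀ (u v : V) (_ : (openGraph ω ⊔ wired B).Walk u v),
        (openGraph ω).Reachable x u → (openGraph ω).Reachable x v := by
    intro x hx u v W
    induction W with
    | nil => exact id
    | @cons a b c hab _ ih =>
      intro ha
      refine ih ?_
      rw [SimpleGraph.sup_adj] at hab
      rcases hab with hab | hab
      · exact ha.trans hab.reachable
      · exfalso
        rw [wired_adj] at hab
        refine Set.disjoint_left.1 hx ?_ hab.2.1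
        rw [SimpleGraph.ConnectedComponent.mem_supp_iff, SimpleGraph.ConnectedComponent.eq]
        exact ha.symm
  have hinj : ∀ x y : V, Disjoint (((openGraph ω).connectedComponentMk x).supp) B →
      φ ((openGraph ω).connectedComponentMk x) = φ ((openGraph ω).connectedComponentMk y) →
      (openGraph ω).connectedComponentMk x = (openGraph ω).connectedComponentMk y := by
    intro x y hx h
    rw [hφmk, hφmk, SimpleGraph.ConnectedComponent.eq] at h
    obtain ⟨W⟩ := h
    rw [SimpleGraph.ConnectedComponent.eq]
    exact hreach x hx x y W (SimpleGraph.Reachable.refl x)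
  have hinjOn : Set.InjOn φ ↑D := by
    intro c₁ hc₁ c₂ _ h
    rw [Finset.mem_coe, hD, Finset.mem_filter] at hc₁
    induction c₁ using SimpleGraph.ConnectedComponent.ind with
    | h x =>
      induction c₂ using SimpleGraph.ConnectedComponent.ind with
      | h y => exact hinj x y hc₁.2 h
  have hsum := sum_ite_inv_ncard_supp_eq_card (openGraph ω) D
  have hite : ∀ x : V, (if (openGraph ω).connectedComponentMk x ∈ D
        then ((((openGraph ω).connectedComponentMk x).supp.ncard : ℝ))⁻¹ else 0) =
      (if Disjoint (openCluster ω x) B then (((openCluster ω x).ncard : ℝ))⁻¹ else 0) := by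
    intro x
    simp only [hD, Finset.mem_filter, Finset.mem_univ, true_and, ← openCluster_eq_supp]
  simp_rw [hite] at hsum
  rw [hsum, clusterCount]
  have hcard : #D ≤ Nat.card (openGraph ω ⊔ wired B).ConnectedComponent := by
    rw [← Finset.card_image_of_injOn hinjOn, Nat.card_eq_fintype_card, ← Finset.card_univ]
    exact Finset.card_le_card (Finset.subset_univ _)
  exact_mod_cast hcard

/-- The expectation of a function nonnegative on edge sets is nonnegative. [folklore] -/
theorem rcExpect_nonneg {W : Type*} [Fintype W] [DecidableEq W] (G : SimpleGraph W) [DecidableRel G.Adj] {p q : ℝ}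
    (hp : p ∈ Set.Icc (0 : ℝ) 1) (hq : 0 < q) (B : Set W) {g : Finset (Sym2 W) → ℝ}
    (hg : ∀ ω ⊆ G.edgeFinset, 0 ≤ g ω) : 0 ≤ rcExpect G p q B g := by
  have h := rcExpect_mono G hp hq B (g := fun _ => (0 : ℝ)) (h := g) hg
  rwa [rcExpect_const G hp hq] at h

end Comb

variable {d : ℕ} {p q : ℝ}

/-! ### Per deep site: the truncated level sum bounds `E¹_{Λ_N}[1{C_x ∩ ∂Λ_N = ∅}·|C_x|⁻¹]` from below -/

section PerSite

/-- **Per deep site, wired: `Σ_{k=2}^{K} (1 − φ¹_{Λ_m,p,q}(|C_0| ≥ k))/((k−1)k) ≤ E¹_{Λ_N,p,q}[1{C_x ∩ ∂Λ_N = ∅}·|C_x|⁻¹]`**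
for `x + Λ_m ⊆ Λ_N`, `K ≤ m`, `K ≤ |Λ_N|` (`0 ≤ p ≤ 1`, `q ≥ 1`): expand the integrand in the decreasing level events
`{C_x ∩ ∂Λ_N = ∅, |C_x| < k}` (`BoxClusterCountWired`), keep the levels `k ≤ K`, note that a cluster of the deep site
`x` with fewer than `k ≤ m` vertices cannot reach `∂Λ_N`, and transport `φ¹_{Λ_N}(|C_x| ≥ k) ≤ φ¹_{Λ_m}(|C_0| ≥ k)`.
[cite: Grimmett2006, proof of Thm. (4.58), (4.81)–(4.83); Thm. (4.19)(a) eq. (4.24)] -/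
theorem sum_le_rcExpect_ite_inv_ncard_true_of_deep (hp : p ∈ Set.Icc (0 : ℝ) 1) (hq : 1 ≤ q) {m N K : ℕ}
    (hKm : K ≤ m) (hKN : K ≤ Fintype.card ↥(box d N)) (x : ↥(box d N)) (hx : siteRad (x : Site d) + m ≤ N) :
    ∑ k ∈ Finset.Icc 2 K,
        (1 - (rcBoxMeasure d true p q m).real (clusterSizeGe (⟨0, zero_mem_box d m⟩ : ↥(box d m)) k)) /
          (((k : ℝ) - 1) * k) ≤
      rcExpect (finsetGraph (zdGraph d) (box d N)) p q (boxBC d true N)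
        (fun ω => if Disjoint (openCluster (↑ω : BondConfig ↥(box d N)) x) (boxBC d true N)
          then (((openCluster (↑ω : BondConfig ↥(box d N)) x).ncard : ℝ))⁻¹ else 0) := by
  have hq0 : 0 < q := one_pos.trans_le hq
  set M := Fintype.card ↥(box d N) with hM
  haveI := isProbabilityMeasure_rcMeasure (finsetGraph (zdGraph d) (box d N)) hp hq0 (boxBC d true N)
  -- expand the integrand
  have hfun : (fun ω : Finset (Sym2 ↥(box d N)) =>
      if Disjoint (openCluster (↑ω : BondConfig ↥(box d N)) x) (boxBC d true N)
        then (((openCluster (↑ω : BondConfig ↥(box d N)) x).ncard : ℝ))⁻¹ else 0) =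
      fun ω : Finset (Sym2 ↥(box d N)) =>
        (1 / (M : ℝ)) * (if (↑ω : BondConfig ↥(box d N)) ∈
            {ω : BondConfig ↥(box d N) | Disjoint (openCluster ω x) (boxBC d true N)} then (1 : ℝ) else 0) +
        ∑ k ∈ Finset.Icc 2 M, (1 / (((k : ℝ) - 1) * k)) *
          (if (↑ω : BondConfig ↥(box d N)) ∈ {ω : BondConfig ↥(box d N) |
              Disjoint (openCluster ω x) (boxBC d true N) ∧ ¬ (k : ℕ∞) ≤ (openCluster ω x).encard}
            then (1 : ℝ) else 0) := by
    funext ω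
    rw [ite_inv_ncard_openCluster_eq_sum, ← hM]
    simp only [Set.mem_setOf_eq, mul_ite, mul_one, mul_zero]
  rw [hfun, rcExpect_add, rcExpect_const_mul, rcExpect_finset_sum]
  -- the boundary term is nonnegative
  have h0 : 0 ≤ (1 / (M : ℝ)) * rcExpect (finsetGraph (zdGraph d) (box d N)) p q (boxBC d true N)
      (fun ω => if (↑ω : BondConfig ↥(box d N)) ∈
        {ω : BondConfig ↥(box d N) | Disjoint (openCluster ω x) (boxBC d true N)} then (1 : ℝ) else 0) := by
    rw [← rcMeasure_real_eq_rcExpect _ hp hq0]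
    exact mul_nonneg (by positivity) measureReal_nonneg
  -- the level terms are nonnegative
  have hnn : ∀ k ∈ Finset.Icc 2 M, 0 ≤
      rcExpect (finsetGraph (zdGraph d) (box d N)) p q (boxBC d true N) (fun ω => (1 / (((k : ℝ) - 1) * k)) *
        (if (↑ω : BondConfig ↥(box d N)) ∈ {ω : BondConfig ↥(box d N) |
            Disjoint (openCluster ω x) (boxBC d true N) ∧ ¬ (k : ℕ∞) ≤ (openCluster ω x).encard} then (1 : ℝ) else 0)) := by
    intro k hk
    have hk2 : (2 : ℝ) ≤ k := by exact_mod_cast (Finset.mem_Icc.1 hk).1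
    rw [rcExpect_const_mul, ← rcMeasure_real_eq_rcExpect _ hp hq0]
    exact mul_nonneg (div_nonneg zero_le_one (by nlinarith)) measureReal_nonneg
  -- the level terms `k ≤ K` dominate the transported ones
  have hk : ∀ k ∈ Finset.Icc 2 K,
      (1 - (rcBoxMeasure d true p q m).real (clusterSizeGe (⟨0, zero_mem_box d m⟩ : ↥(box d m)) k)) /
          (((k : ℝ) - 1) * k) ≤
      rcExpect (finsetGraph (zdGraph d) (box d N)) p q (boxBC d true N) (fun ω => (1 / (((k : ℝ) - 1) * k)) *
        (if (↑ω : BondConfig ↥(box d N)) ∈ {ω : BondConfig ↥(box d N) |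
            Disjoint (openCluster ω x) (boxBC d true N) ∧ ¬ (k : ℕ∞) ≤ (openCluster ω x).encard} then (1 : ℝ) else 0)) := by
    intro k hk
    have hk2 : (2 : ℝ) ≤ k := by exact_mod_cast (Finset.mem_Icc.1 hk).1
    have hkK : k ≤ K := (Finset.mem_Icc.1 hk).2
    rw [rcExpect_const_mul, ← rcMeasure_real_eq_rcExpect _ hp hq0, div_eq_mul_one_div, mul_comm]
    refine mul_le_mul_of_nonneg_left ?_ (div_nonneg zero_le_one (by nlinarith))
    have h1 := rcBoxMeasure_true_real_clusterSizeGe_le_center hp hq x hx (hkK.trans hKm)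
    have h2 : (rcBoxMeasure d true p q N).real (clusterSizeGe x k)ᶜ ≤
        (rcMeasure (finsetGraph (zdGraph d) (box d N)) p q (boxBC d true N)).real
          {ω : BondConfig ↥(box d N) |
            Disjoint (openCluster ω x) (boxBC d true N) ∧ ¬ (k : ℕ∞) ≤ (openCluster ω x).encard} := by
      rw [rcBoxMeasure]
      refine rcMeasure_real_mono_on_edgeSets _ hp hq0 _ fun ω hω hωk => ?_
      rw [Set.mem_compl_iff, mem_clusterSizeGe] at hωk
      exact ⟨disjoint_openCluster_boxBC_of_not_le_encard hω x (by omega) hωk, hωk⟩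
    haveI := isProbabilityMeasure_rcBoxMeasure true hp hq0 N (d := d)
    rw [probReal_compl_eq_one_sub (measurableSet_clusterSizeGe _ _)] at h2
    linarith
  -- abbreviate the level terms and sum up
  set L : ℕ → ℝ := fun k => rcExpect (finsetGraph (zdGraph d) (box d N)) p q (boxBC d true N)
    (fun ω => (1 / (((k : ℝ) - 1) * k)) *
      (if (↑ω : BondConfig ↥(box d N)) ∈ {ω : BondConfig ↥(box d N) |
          Disjoint (openCluster ω x) (boxBC d true N) ∧ ¬ (k : ℕ∞) ≤ (openCluster ω x).encard} then (1 : ℝ) else 0))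
    with hL
  calc ∑ k ∈ Finset.Icc 2 K,
        (1 - (rcBoxMeasure d true p q m).real (clusterSizeGe (⟨0, zero_mem_box d m⟩ : ↥(box d m)) k)) /
          (((k : ℝ) - 1) * k)
      ≤ ∑ k ∈ Finset.Icc 2 K, L k := Finset.sum_le_sum hk
    _ ≤ ∑ k ∈ Finset.Icc 2 M, L k :=
        Finset.sum_le_sum_of_subset_of_nonneg (Finset.Icc_subset_Icc_right hKN) fun k hk _ => hnn k hk
    _ ≤ _ := le_add_of_nonneg_left h0

end PerSite

/-! ### The sum over the box -/

section Sum

/-- **`Σ_x E^B_{G,p,q}[1{C_x ∩ B = ∅}·|C_x|⁻¹] ≤ E^B_{G,p,q}[k^B(ω)]`** for every wired class `B` of a finite graph.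
[cite: Grimmett2006, §4.2 (4.12) and proof of Thm. (4.58)] -/
theorem sum_rcExpect_ite_inv_ncard_le_rcExpect_clusterCount {W : Type*} [Fintype W] [DecidableEq W]
    (G : SimpleGraph W) [DecidableRel G.Adj] (hp : p ∈ Set.Icc (0 : ℝ) 1) (hq : 0 < q) (B : Set W) :
    ∑ x : W, rcExpect G p q B
        (fun ω => if Disjoint (openCluster (↑ω : BondConfig W) x) B
          then (((openCluster (↑ω : BondConfig W) x).ncard : ℝ))⁻¹ else 0) ≤
      rcExpect G p q B (fun ω => (clusterCount (↑ω : BondConfig W) B : ℝ)) := by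
  rw [← rcExpect_finset_sum]
  exact rcExpect_mono _ hp hq _ fun ω _ => sum_ite_inv_ncard_le_clusterCount _ _

/-- **`(|Λ_{N−m}|/|Λ_N|)·Σ_{k=2}^{K} (1 − φ¹_{Λ_m,p,q}(|C_0| ≥ k))/((k−1)k) ≤ |Λ_N|⁻¹ Σ_x E¹_{Λ_N,p,q}[1{C_x ∩ ∂Λ_N = ∅}·|C_x|⁻¹]`**
for `m ≤ N`, `K ≤ m`, `K ≤ |Λ_N|` (`0 ≤ p ≤ 1`, `q ≥ 1`): the per-site bound at the `|Λ_{N−m}|` deep sites, `≥ 0`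
elsewhere. [cite: Grimmett2006, proof of Thm. (4.58), (4.81)–(4.83)] -/
theorem mul_sum_le_sum_rcExpect_ite_inv_ncard_true_div (hp : p ∈ Set.Icc (0 : ℝ) 1) (hq : 1 ≤ q) {m N K : ℕ}
    (hmN : m ≤ N) (hKm : K ≤ m) (hKN : K ≤ Fintype.card ↥(box d N)) :
    (#(box d (N - m)) : ℝ) / #(box d N) * ∑ k ∈ Finset.Icc 2 K,
        (1 - (rcBoxMeasure d true p q m).real (clusterSizeGe (⟨0, zero_mem_box d m⟩ : ↥(box d m)) k)) /
          (((k : ℝ) - 1) * k) ≤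
      (∑ x : ↥(box d N), rcExpect (finsetGraph (zdGraph d) (box d N)) p q (boxBC d true N)
        (fun ω => if Disjoint (openCluster (↑ω : BondConfig ↥(box d N)) x) (boxBC d true N)
          then (((openCluster (↑ω : BondConfig ↥(box d N)) x).ncard : ℝ))⁻¹ else 0)) / #(box d N) := by
  have hq0 : 0 < q := one_pos.trans_le hq
  set T := ∑ k ∈ Finset.Icc 2 K,
    (1 - (rcBoxMeasure d true p q m).real (clusterSizeGe (⟨0, zero_mem_box d m⟩ : ↥(box d m)) k)) /
      (((k : ℝ) - 1) * k) with hT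
  have hcardpos : (0 : ℝ) < #(box d N) := by exact_mod_cast Finset.card_pos.2 (box_nonempty d N)
  -- per site: `≥ T` on deep sites, `≥ 0` elsewhere
  set D : Finset ↥(box d N) := Finset.univ.filter fun x : ↥(box d N) => (x : Site d) ∈ box d (N - m) with hD
  have hle : ∀ x : ↥(box d N), (if x ∈ D then T else 0) ≤
      rcExpect (finsetGraph (zdGraph d) (box d N)) p q (boxBC d true N)
        (fun ω => if Disjoint (openCluster (↑ω : BondConfig ↥(box d N)) x) (boxBC d true N)
          then (((openCluster (↑ω : BondConfig ↥(box d N)) x).ncard : ℝ))⁻¹ else 0) := by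
    intro x
    by_cases hx : x ∈ D
    · rw [if_pos hx]
      have hx' : (x : Site d) ∈ box d (N - m) := (Finset.mem_filter.1 hx).2
      exact sum_le_rcExpect_ite_inv_ncard_true_of_deep hp hq hKm hKN x (siteRad_add_le_of_mem_box_sub hmN hx')
    · rw [if_neg hx]
      refine rcExpect_nonneg _ hp hq0 _ fun ω _ => ?_
      split_ifs
      · positivity
      · exact le_rfl
  have hsum := Finset.sum_le_sum fun x (_ : x ∈ (Finset.univ : Finset ↥(box d N))) => hle x
  rw [← Finset.sum_filter, Finset.sum_const] at hsum
  have hDcard : #(Finset.univ.filter fun x : ↥(box d N) => x ∈ D) = #(box d (N - m)) := by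
    rw [← card_filter_coe_mem_box_sub m N, ← hD]
    congr 1
    ext x
    simp
  rw [hDcard, nsmul_eq_mul] at hsum
  rw [le_div_iff₀ hcardpos, mul_comm, ← mul_assoc, mul_div_cancel₀ _ hcardpos.ne']
  exact hsum

/-- **`(|Λ_{N−m}|/|Λ_N|)·Σ_{k=2}^{K} (1 − φ¹_{Λ_m,p,q}(|C_0| ≥ k))/((k−1)k) ≤ |Λ_N|⁻¹ E¹_{Λ_N,p,q}[k¹(ω)]`** for `m ≤ N`,
`K ≤ m`, `K ≤ |Λ_N|` (`0 ≤ p ≤ 1`, `q ≥ 1`), since `k¹ ≥ Σ_x 1{C_x ∩ ∂Λ_N = ∅}·|C_x|⁻¹`.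
[cite: Grimmett2006, proof of Thm. (4.58), (4.81)–(4.83)] -/
theorem mul_sum_le_rcExpect_clusterCount_true_div (hp : p ∈ Set.Icc (0 : ℝ) 1) (hq : 1 ≤ q) {m N K : ℕ}
    (hmN : m ≤ N) (hKm : K ≤ m) (hKN : K ≤ Fintype.card ↥(box d N)) :
    (#(box d (N - m)) : ℝ) / #(box d N) * ∑ k ∈ Finset.Icc 2 K,
        (1 - (rcBoxMeasure d true p q m).real (clusterSizeGe (⟨0, zero_mem_box d m⟩ : ↥(box d m)) k)) /
          (((k : ℝ) - 1) * k) ≤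
      rcExpect (finsetGraph (zdGraph d) (box d N)) p q (boxBC d true N)
        (fun ω => (clusterCount (↑ω : BondConfig ↥(box d N)) (boxBC d true N) : ℝ)) / #(box d N) := by
  refine (mul_sum_le_sum_rcExpect_ite_inv_ncard_true_div hp hq hmN hKm hKN).trans ?_
  exact div_le_div_of_nonneg_right
    (sum_rcExpect_ite_inv_ncard_le_rcExpect_clusterCount _ hp (one_pos.trans_le hq) _) (Nat.cast_nonneg _)

end Sum

/-! ### The limit -/

section Limit

/-- **Lower bound in the limit, for the clusters avoiding the boundary: for every `ε > 0`, eventually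
`κ¹(p,q) − ε ≤ |Λ_N|⁻¹ Σ_x E¹_{Λ_N,p,q}[1{C_x ∩ ∂Λ_N = ∅}·|C_x|⁻¹]`** (`d ≥ 1`, `0 ≤ p ≤ 1`, `q ≥ 1`;
`κ¹(p,q) = ∫ |C_0|⁻¹ dφ¹_{p,q}`). Choose `K` with `2/K ≤ ε/3`, then `m ≥ K` with
`Σ_{k=2}^{K} (1 − φ¹_{Λ_m}(|C_0| ≥ k))/((k−1)k) ≥ Σ_{k=2}^{K} (1 − φ¹(|C_0| ≥ k))/((k−1)k) − ε/3 ≥ κ¹ − 2ε/3`, then `N` large.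
[cite: Grimmett2006, proof of Thm. (4.58), (4.81)–(4.83)] -/
theorem eventually_le_sum_rcExpect_ite_inv_ncard_true_div (hd : 0 < d) (hp : p ∈ Set.Icc (0 : ℝ) 1) (hq : 1 ≤ q)
    {ε : ℝ} (hε : 0 < ε) :
    ∀ᶠ N : ℕ in atTop, ∫ ω, ((openCluster ω (0 : Site d)).ncard : ℝ)⁻¹ ∂(rcLimit d true p q) - ε ≤
      (∑ x : ↥(box d N), rcExpect (finsetGraph (zdGraph d) (box d N)) p q (boxBC d true N)
        (fun ω => if Disjoint (openCluster (↑ω : BondConfig ↥(box d N)) x) (boxBC d true N)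
          then (((openCluster (↑ω : BondConfig ↥(box d N)) x).ncard : ℝ))⁻¹ else 0)) / #(box d N) := by
  haveI := isProbabilityMeasure_rcLimit (d := d) true p q
  set κ₁ := ∫ ω, ((openCluster ω (0 : Site d)).ncard : ℝ)⁻¹ ∂(rcLimit d true p q) with hκ₁
  -- `K` with `1/K ≤ ε/6`
  obtain ⟨K₀, hK₀⟩ := exists_nat_one_div_lt (show 0 < ε / 6 by positivity)
  set K := K₀ + 1 with hK
  have hK1 : 1 ≤ K := by omega
  have hKε : (1 : ℝ) / K ≤ ε / 6 := by rw [hK]; push_cast; exact hK₀.le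
  -- the infinite-volume truncation: `Tinf ≥ κ₁ − 2/K`
  set Tinf := ∑ k ∈ Finset.Icc 2 K, (1 - (rcLimit d true p q).real (clusterSizeGe (0 : Site d) k)) / (((k : ℝ) - 1) * k)
    with hTinf
  have hinf : κ₁ - ε / 3 ≤ Tinf := by
    have h := (abs_le.1 (abs_integral_inv_ncard_sub_le (rcLimit d true p q) (0 : Site d) K hK1)).2
    have hsplit : Tinf = (∑ k ∈ Finset.Icc 2 K, (1 : ℝ) / (((k : ℝ) - 1) * k)) -
        ∑ k ∈ Finset.Icc 2 K, (rcLimit d true p q).real (clusterSizeGe (0 : Site d) k) / (((k : ℝ) - 1) * k) := by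
      rw [hTinf, ← Finset.sum_sub_distrib]
      refine Finset.sum_congr rfl fun k _ => ?_
      ring
    rw [hsplit, sum_Icc_inv_mul_eq K hK1]
    linarith
  -- `m ≥ K` with `T m ≥ Tinf − ε/3`
  set T : ℕ → ℝ := fun m => ∑ k ∈ Finset.Icc 2 K,
    (1 - (rcBoxMeasure d true p q m).real (clusterSizeGe (⟨0, zero_mem_box d m⟩ : ↥(box d m)) k)) /
      (((k : ℝ) - 1) * k) with hTdef
  have hTlim : Tendsto T atTop (𝓝 Tinf) :=
    tendsto_finsetSum _ fun k _ =>
      (tendsto_const_nhds.sub (tendsto_rcBoxMeasure_real_clusterSizeGe_center true hp hq k)).div_const _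
  obtain ⟨m, hm, hKm⟩ := (((Metric.tendsto_nhds.1 hTlim) (ε / 3) (by positivity)).and (eventually_ge_atTop K)).exists
  have hm' : Tinf - ε / 3 ≤ T m := by
    rw [Real.dist_eq] at hm
    have := (abs_lt.1 hm).1
    linarith
  haveI := isProbabilityMeasure_rcBoxMeasure true hp (one_pos.trans_le hq) m (d := d)
  have hT1 : T m ≤ 1 := by
    have h : T m = ∑ k ∈ Finset.Icc 2 K, (rcBoxMeasure d true p q m).real
        (clusterSizeGe (⟨0, zero_mem_box d m⟩ : ↥(box d m)) k)ᶜ / (((k : ℝ) - 1) * k) := by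
      refine Finset.sum_congr rfl fun k _ => ?_
      rw [probReal_compl_eq_one_sub (measurableSet_clusterSizeGe _ _)]
    rw [h]
    exact sum_Icc_measureReal_div_le_one _ _ K
  have hT0 : 0 ≤ T m := Finset.sum_nonneg fun k hk => by
    have hk2 : (2 : ℝ) ≤ k := by exact_mod_cast (Finset.mem_Icc.1 hk).1
    exact div_nonneg (sub_nonneg.2 measureReal_le_one) (by nlinarith)
  -- `N` large: `N ≥ m`, `K ≤ |Λ_N|`, `|Λ_{N−m}|/|Λ_N| ≥ 1 − ε/3`
  have hratio : ∀ᶠ N : ℕ in atTop, 1 - ε / 3 ≤ (#(box d (N - m)) : ℝ) / #(box d N) := by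
    have h := tendsto_card_box_sub_div_card_box (d := d) m
    exact (h.eventually (eventually_ge_nhds (show 1 - ε / 3 < (1 : ℝ) by linarith))).mono fun N hN => hN
  have hKN : ∀ᶠ N : ℕ in atTop, K ≤ Fintype.card ↥(box d N) := by
    filter_upwards [eventually_ge_atTop K] with N hN
    rw [Fintype.card_coe, card_box]
    calc K ≤ N := hN
      _ ≤ 2 * N + 1 := by omega
      _ ≤ (2 * N + 1) ^ d := Nat.le_self_pow hd.ne' _
  filter_upwards [hratio, hKN, eventually_ge_atTop m] with N hrN hKN' hmN
  have hmain := mul_sum_le_sum_rcExpect_ite_inv_ncard_true_div hp hq hmN hKm hKN' (d := d)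
  -- `r T ≥ (1 − ε/3) T ≥ T − ε/3 ≥ Tinf − 2ε/3 ≥ κ₁ − ε`
  have h1 : T m - ε / 3 ≤ (#(box d (N - m)) : ℝ) / #(box d N) * T m := by nlinarith
  linarith

/-- **Lower bound in the limit: for every `ε > 0`, eventually `κ¹(p,q) − ε ≤ |Λ_N|⁻¹ E¹_{Λ_N,p,q}[k¹(ω)]`** (`d ≥ 1`,
`0 ≤ p ≤ 1`, `q ≥ 1`). [cite: Grimmett2006, proof of Thm. (4.58), (4.81)–(4.83)] -/
theorem eventually_le_rcExpect_clusterCount_true_div (hd : 0 < d) (hp : p ∈ Set.Icc (0 : ℝ) 1) (hq : 1 ≤ q)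
    {ε : ℝ} (hε : 0 < ε) :
    ∀ᶠ N : ℕ in atTop, ∫ ω, ((openCluster ω (0 : Site d)).ncard : ℝ)⁻¹ ∂(rcLimit d true p q) - ε ≤
      rcExpect (finsetGraph (zdGraph d) (box d N)) p q (boxBC d true N)
        (fun ω => (clusterCount (↑ω : BondConfig ↥(box d N)) (boxBC d true N) : ℝ)) / #(box d N) := by
  filter_upwards [eventually_le_sum_rcExpect_ite_inv_ncard_true_div hd hp hq hε] with N hN
  refine hN.trans (div_le_div_of_nonneg_right ?_ (Nat.cast_nonneg _))
  exact sum_rcExpect_ite_inv_ncard_le_rcExpect_clusterCount _ hp (one_pos.trans_le hq) _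

/-- **Grimmett 2006, (4.81)–(4.83), wired boundary condition, as a limit: the mean number of open clusters per site
of the wired box measures (boundary clusters counted as one) converges to the wired cluster density,
`|Λ_N|⁻¹ E¹_{Λ_N,p,q}[k¹(ω)] → κ¹(p,q) = ∫ |C_0|⁻¹ dφ¹_{p,q}`** (`d ≥ 1`, `0 ≤ p ≤ 1`, `q ≥ 1`; no ergodic theorem:
the upper bound is `BoxClusterCountWired`, the lower bound the deep-site comparison of this file).
[cite: Grimmett2006, proof of Thm. (4.58) and of Lemma (4.79), (4.80)–(4.84)] -/
theorem tendsto_rcExpect_clusterCount_div_card_box_true (hd : 0 < d) (hp : p ∈ Set.Icc (0 : ℝ) 1) (hq : 1 ≤ q) :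
    Tendsto (fun N : ℕ => rcExpect (finsetGraph (zdGraph d) (box d N)) p q (boxBC d true N)
        (fun ω => (clusterCount (↑ω : BondConfig ↥(box d N)) (boxBC d true N) : ℝ)) / #(box d N)) atTop
      (𝓝 (∫ ω, ((openCluster ω (0 : Site d)).ncard : ℝ)⁻¹ ∂(rcLimit d true p q))) := by
  set κ₁ := ∫ ω, ((openCluster ω (0 : Site d)).ncard : ℝ)⁻¹ ∂(rcLimit d true p q) with hκ₁
  rw [tendsto_order]
  refine ⟨fun a ha => ?_, fun b hb => ?_⟩
  · have hε : 0 < (κ₁ - a) / 2 := by linarith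
    filter_upwards [eventually_le_rcExpect_clusterCount_true_div hd hp hq hε] with N hN
    linarith
  · have hδ : 0 < (b - κ₁) / 2 := by linarith
    filter_upwards [eventually_rcExpect_clusterCount_div_le_integral_add hd hp hq hδ] with N hN
    linarith

end Limit

end Summit.CriticalPhenomena.PercolationContinuityZ3.Theorems.FK

end
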